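/-
Copyright (c) 2026 The decomp-a2c cell. All rights reserved.
Released under Apache 2.0 license as described in the file LICENSE.
-/
import Summits.AtomisticToContinuum.Crystallization.Theorems.ChartedZeroExcessLayeredLatticeLiouvilleWU

/-!
# ChartedZeroExcessLayeredLatticeLiouville — part WV «BootstrapCubic»: the window bootstrap with the CUBIC a-priori threshold
  (decomp-a2c-lens-2, g58; helper of stmt-AtomisticToContinuum-26636, leaf (PC) `ProfileComparisonAt`; sharpening of part WT)

Part WT's bootstrap asks `S·B₀ ≤ L'²·ε₁` of the a-priori increment bound `B₀`; the only a-priori bound available for the comparison profile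
`φ x₀.1 − cf` is the crude single-bond bound `B₀ ≍ n·√#ball·ε₁·(ϱ-dependent)`, which meets a CUBIC threshold (`L' ≍ n`, `√#ball ≍ n^{3/2}`) for
`n ≥ n₁(ϱ)` but never the quadratic one.  This part re-runs WT's maximiser argument keeping track of `R ≥ L' + 1` in the off-range case, where the ring
term `M·S·(R+2)⁻²·B₀ ≤ M·S·B₀·L'³/(L'³(R+2)²) ≤ M·R·ε₁` is compared with `Θ·R·ε₁` instead of `Θ·ε₁`:

  `bootstrap_increment_cubic`: the conclusion of WT, `‖d(k+1) − d k‖ ≤ 4·M·(C_h + 1)·(|k − α₀| + A)·ε₁` on `|k − α₀| + A ≤ 3L'`, under the thresholds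
  `9408·M·K ≤ A³`, `12·M·S ≤ (A+2)²`, `1372·K·B₀ ≤ L'³ε₁`, `S·B₀ ≤ L'³ε₁` (cubic), with
  the data in the offset form `‖chainFlux T d n‖ ≤ C_h(|n − α₀| + A)ε₁`
  (weaker than WT's `(|n − α₀| + 1)` since `A ≥ 1`; it is the form produced by re-anchoring).

All constants stay `ϱ`-free; `B₀` (which may depend on `ϱ`) enters only the two `L'`-thresholds, i.e. the scale threshold `n₁(ϱ)` of (PC).
-/

namespace Summit.AtomisticToContinuum.Crystallization.Theorems.ChartedZeroExcessLayeredLatticeLiouville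

open Summit.AtomisticToContinuum.Crystallization.Theorems.ChartedPlanarOrderRigidityDoor (E3)
open Finset
open scoped InnerProductSpace RealInnerProductSpace BigOperators

noncomputable section BootstrapCubic

variable {c : ℝ} {a b : E3} {w : ℤ → E3}

/-! ### WV.1  The bootstrap with the cubic threshold -/
set_option maxHeartbeats 400000 in
/-- ★★★ THE `ϱ`-FREE WINDOW BOOTSTRAP, CUBIC THRESHOLD: chain fluxes `≤ C_h(|n − α₀| + A)ε₁` on `|n − α₀| ≤ 6L'`, an a-priori bound `B₀` on
`|k − α₀| ≤ 9L' + ⌊ϱ/c⌋₊` with `1372·K·B₀ ≤ L'³ε₁` and `S·B₀ ≤ L'³ε₁`, and `9408·M·K ≤ A³`, `12·M·S ≤ (A+2)²` force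
`‖d(k+1) − d k‖ ≤ 4·M·(C_h + 1)·(|k − α₀| + A)·ε₁` on `|k − α₀| + A ≤ 3L'`. [this file, g58] -/
theorem bootstrap_increment_cubic (hc : 0 < c) (hL : IsLayeredCrystal c a b w) {κ₀ ε ϱ : ℝ} (hϱ : 0 ≤ ϱ) (hε : ε < 2 * κ₀)
    (hK : CoerciveZ (layeredKernel a b w) κ₀)
    (hT : ∀ φ : Cell 2 → ℤ → E3, HasFiniteSupport φ → Summable (tailFam ϱ a b w φ) ∧ ∑' x, tailFam ϱ a b w φ x ≤ ε * nnFormZ φ)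
    (d : ℤ → E3) {T : Finset ℤ} (α₀ : ℤ) {A L' : ℕ} (hA : 1 ≤ A) (hL' : 1 ≤ L') {Ch ε₁ B₀ : ℝ} (hCh : 0 ≤ Ch) (hε₁ : 0 < ε₁) (hB₀ : 0 ≤ B₀)
    (hTc : ∀ n : ℤ, (n - α₀).natAbs ≤ 6 * L' → Icc (n - ⌊ϱ / c⌋₊) (n + 1 + ⌊ϱ / c⌋₊) ⊆ T)
    (hCF : ∀ n : ℤ, (n - α₀).natAbs ≤ 6 * L' → ‖chainFlux ϱ a b w T d n‖ ≤ Ch * (((((n - α₀).natAbs : ℕ)) : ℝ) + A) * ε₁)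
    (hBd : ∀ k : ℤ, (k - α₀).natAbs ≤ 9 * L' + ⌊ϱ / c⌋₊ → ‖d (k + 1) - d k‖ ≤ B₀)
    (hA1 : 9408 * modeConst c (κ₀ - ε / 2) * kernelConst c ≤ ((A : ℕ) : ℝ) ^ 3)
    (hA2 : 12 * modeConst c (κ₀ - ε / 2) * stabConst c (κ₀ - ε / 2) ≤ (((A : ℕ) : ℝ) + 2) ^ 2)
    (hL1 : 1372 * kernelConst c * B₀ ≤ ((L' : ℕ) : ℝ) ^ 3 * ε₁) (hL2 : stabConst c (κ₀ - ε / 2) * B₀ ≤ ((L' : ℕ) : ℝ) ^ 3 * ε₁)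
    {k : ℤ} (hk : (k - α₀).natAbs + A ≤ 3 * L') :
    ‖d (k + 1) - d k‖ ≤ 4 * modeConst c (κ₀ - ε / 2) * (Ch + 1) * (((((k - α₀).natAbs : ℕ)) : ℝ) + A) * ε₁ := by
  set M := modeConst c (κ₀ - ε / 2) with hM
  set S := stabConst c (κ₀ - ε / 2) with hS
  have hδ : 0 < κ₀ - ε / 2 := by linarith
  have hM0 : 0 ≤ M := modeConst_nonneg c hδ
  have hS0 : 0 ≤ S := stabConst_nonneg hc _
  have hK0 := kernelConst_nonneg hc
  have hL'r : (1 : ℝ) ≤ ((L' : ℕ) : ℝ) := by exact_mod_cast hL'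
  have hAr : (1 : ℝ) ≤ ((A : ℕ) : ℝ) := by exact_mod_cast hA
  -- the weights and the range
  set wt : ℤ → ℝ := fun j => (((((j - α₀).natAbs : ℕ)) : ℝ) + A) * ε₁ with hwt
  have hwpos : ∀ j, 0 < wt j := fun j => by positivity
  set I : Finset ℤ := (Icc (α₀ - 3 * L') (α₀ + 3 * L')).filter (fun j => (j - α₀).natAbs + A ≤ 3 * L') with hI
  have hmemI : ∀ j : ℤ, (j - α₀).natAbs + A ≤ 3 * L' → j ∈ I := fun j hj =>
    mem_filter.mpr ⟨by rw [mem_Icc]; omega, hj⟩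
  -- the maximiser of the ratio
  obtain ⟨k₀, hk₀I, hmax⟩ := exists_max_image I (fun j => ‖d (j + 1) - d j‖ / wt j) ⟨k, hmemI k hk⟩
  have hk₀ : (k₀ - α₀).natAbs + A ≤ 3 * L' := (mem_filter.mp hk₀I).2
  set Θ := ‖d (k₀ + 1) - d k₀‖ / wt k₀ with hΘ
  have hΘ0 : 0 ≤ Θ := div_nonneg (norm_nonneg _) (hwpos k₀).le
  have hrat : ∀ j : ℤ, (j - α₀).natAbs + A ≤ 3 * L' → ‖d (j + 1) - d j‖ ≤ Θ * wt j := fun j hj =>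
    (div_le_iff₀ (hwpos j)).mp (hmax j (hmemI j hj))
  have hat : ‖d (k₀ + 1) - d k₀‖ = Θ * wt k₀ := (div_mul_cancel₀ _ (hwpos k₀).ne').symm
  -- it suffices to bound the maximal ratio
  suffices hΘle : Θ ≤ 4 * M * (Ch + 1) by
    calc ‖d (k + 1) - d k‖ ≤ Θ * wt k := hrat k hk
      _ ≤ 4 * M * (Ch + 1) * wt k := mul_le_mul_of_nonneg_right hΘle (hwpos k).le
      _ = 4 * M * (Ch + 1) * (((((k - α₀).natAbs : ℕ)) : ℝ) + A) * ε₁ := by simp only [hwt]; ring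
  -- the window at the maximiser
  obtain ⟨R, hR⟩ : ∃ R : ℕ, R = (k₀ - α₀).natAbs + A := ⟨_, rfl⟩
  have hR1 : 1 ≤ R := by omega
  have hRr : (1 : ℝ) ≤ ((R : ℕ) : ℝ) := by exact_mod_cast hR1
  have hRA : ((A : ℕ) : ℝ) ≤ ((R : ℕ) : ℝ) := by exact_mod_cast (show A ≤ R by omega)
  have hRe : ((R : ℕ) : ℝ) = ((((k₀ - α₀).natAbs : ℕ)) : ℝ) + A := by rw [hR]; push_cast; ring
  have hX : ‖d (k₀ + 1) - d k₀‖ = Θ * R * ε₁ := by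
    rw [hat, hRe]
    simp only [hwt]
    ring
  have hΘε : 0 ≤ Θ * ε₁ := by positivity
  have hWT : Icc (k₀ - R) (k₀ + R) ⊆ Icc (k₀ - 2 * R) (k₀ + 2 * R) := fun x hx => by rw [mem_Icc] at hx ⊢; omega
  -- the far-band bound on the inner window (part WS)
  have hH : ∀ n ∈ Icc (k₀ - R) (k₀ + R), ‖blockApply (fluxBlock hc hL ϱ) (Icc (k₀ - 2 * R) (k₀ + 2 * R)) (fun j => d (j + 1) - d j) n‖ ≤
      2 * Ch * R * ε₁ + 196 * kernelConst c * (12 * (Θ * ε₁) * (((((R : ℕ) : ℝ)) + 1)⁻¹) ^ 2 + 7 * B₀ * ((((L' : ℕ) : ℝ))⁻¹) ^ 3) := by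
    intro n hn
    have hn' : (n - α₀).natAbs + A ≤ 2 * R := by rw [mem_Icc] at hn; omega
    have hn6 : (n - α₀).natAbs ≤ 6 * L' := by omega
    have hH₀ : ‖chainFlux ϱ a b w T d n‖ ≤ 2 * Ch * R * ε₁ := by
      refine (hCF n hn6).trans ?_
      have h2 : ((((n - α₀).natAbs : ℕ)) : ℝ) + A ≤ 2 * R := by exact_mod_cast hn'
      calc Ch * (((((n - α₀).natAbs : ℕ)) : ℝ) + A) * ε₁ ≤ Ch * (2 * R) * ε₁ :=
            mul_le_mul_of_nonneg_right (mul_le_mul_of_nonneg_left h2 hCh) hε₁.le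
        _ = 2 * Ch * R * ε₁ := by ring
    refine norm_blockApply_far_le hc hL d hL' hn (hTc n hn6) hΘε hB₀ hH₀ fun j hjb hjT => ?_
    have hfar := natAbs_ge_of_far hn hjT
    by_cases hjI : (j - α₀).natAbs + A ≤ 3 * L'
    · left
      have hcmp : (j - α₀).natAbs + A ≤ (n - j).natAbs + 2 * R := by rw [mem_Icc] at hn; omega
      have hcmp' : ((((j - α₀).natAbs : ℕ)) : ℝ) + A ≤ ((((n - j).natAbs : ℕ)) : ℝ) + 2 * R := by exact_mod_cast hcmp
      calc ‖d (j + 1) - d j‖ ≤ Θ * wt j := hrat j hjI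
        _ = Θ * ε₁ * (((((j - α₀).natAbs : ℕ)) : ℝ) + A) := by simp only [hwt]; ring
        _ ≤ Θ * ε₁ * (((((n - j).natAbs : ℕ)) : ℝ) + 2 * R) := mul_le_mul_of_nonneg_left hcmp' hΘε
    · right
      rw [mem_Icc] at hn hjb
      exact ⟨by omega, hBd j (by omega)⟩
  -- the KEY inequality at the maximiser (part WB on the ring, two cases for the ring bound)
  have hKEY : Θ * R * ε₁ ≤ M * (2 * Ch * R * ε₁ + 196 * kernelConst c * (12 * (Θ * ε₁) * (((((R : ℕ) : ℝ)) + 1)⁻¹) ^ 2 +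
      7 * B₀ * ((((L' : ℕ) : ℝ))⁻¹) ^ 3)) + M * (S * (((((R : ℕ) : ℝ)) + 2)⁻¹) ^ 2 * (3 * R * (Θ * ε₁))) +
      M * (ε₁ * R) := by
    have hring : ∀ j ∈ Icc (k₀ - 2 * R) (k₀ + 2 * R) \ Icc (k₀ - R) (k₀ + R), (j - α₀).natAbs + A ≤ 3 * L' → ‖d (j + 1) - d j‖ ≤ 3 * R * (Θ * ε₁) := by
      intro j hj hjI
      have h1 := (mem_sdiff.mp hj).1
      rw [mem_Icc] at h1
      have hjR : (j - α₀).natAbs + A ≤ 3 * R := by omega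
      have hjR' : ((((j - α₀).natAbs : ℕ)) : ℝ) + A ≤ 3 * R := by exact_mod_cast hjR
      calc ‖d (j + 1) - d j‖ ≤ Θ * wt j := hrat j hjI
        _ = Θ * ε₁ * (((((j - α₀).natAbs : ℕ)) : ℝ) + A) := by simp only [hwt]; ring
        _ ≤ Θ * ε₁ * (3 * R) := mul_le_mul_of_nonneg_left hjR' hΘε
        _ = 3 * R * (Θ * ε₁) := by ring
    have hslack : 0 ≤ M * (ε₁ * R) := by positivity
    by_cases hcase : R ≤ L'
    · -- every layer of the block carrier lies in the range
      have hD : ∀ j ∈ Icc (k₀ - 2 * R) (k₀ + 2 * R) \ Icc (k₀ - R) (k₀ + R), ‖(fun j => d (j + 1) - d j) j‖ ≤ 3 * R * (Θ * ε₁) := by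
        intro j hj
        have h1 := (mem_sdiff.mp hj).1
        rw [mem_Icc] at h1
        exact hring j hj (by omega)
      have hWB := increment_le_local hc hL hϱ hε hK hT hWT (fun j => d (j + 1) - d j) (by positivity) hH hD
      have hWB' : ‖d (k₀ + 1) - d k₀‖ ≤ M * (2 * Ch * R * ε₁ + 196 * kernelConst c * (12 * (Θ * ε₁) * (((((R : ℕ) : ℝ)) + 1)⁻¹) ^ 2 +
          7 * B₀ * ((((L' : ℕ) : ℝ))⁻¹) ^ 3) + S * (((((R : ℕ) : ℝ)) + 2)⁻¹) ^ 2 * (3 * R * (Θ * ε₁))) := hWB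
      rw [hX] at hWB'
      linarith [mul_add M (2 * Ch * R * ε₁ + 196 * kernelConst c * (12 * (Θ * ε₁) * (((((R : ℕ) : ℝ)) + 1)⁻¹) ^ 2 +
        7 * B₀ * ((((L' : ℕ) : ℝ))⁻¹) ^ 3)) (S * (((((R : ℕ) : ℝ)) + 2)⁻¹) ^ 2 * (3 * R * (Θ * ε₁)))]
    · -- the block carrier reaches beyond the range: the a-priori bound enters, `S(R+2)⁻²B₀ ≤ L'³ε₁(R+2)⁻² ≤ Rε₁` (here `R ≥ L' + 1`)
      have hD : ∀ j ∈ Icc (k₀ - 2 * R) (k₀ + 2 * R) \ Icc (k₀ - R) (k₀ + R), ‖(fun j => d (j + 1) - d j) j‖ ≤ 3 * R * (Θ * ε₁) + B₀ := by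
        intro j hj
        have h1 := (mem_sdiff.mp hj).1
        rw [mem_Icc] at h1
        by_cases hjI : (j - α₀).natAbs + A ≤ 3 * L'
        · exact (hring j hj hjI).trans (le_add_of_nonneg_right hB₀)
        · have hb := hBd j (by omega)
          have h3 : (0 : ℝ) ≤ 3 * R * (Θ * ε₁) := by positivity
          exact hb.trans (by linarith)
      have hWB := increment_le_local hc hL hϱ hε hK hT hWT (fun j => d (j + 1) - d j) (by positivity) hH hD
      have hWB' : ‖d (k₀ + 1) - d k₀‖ ≤ M * (2 * Ch * R * ε₁ + 196 * kernelConst c * (12 * (Θ * ε₁) * (((((R : ℕ) : ℝ)) + 1)⁻¹) ^ 2 +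
          7 * B₀ * ((((L' : ℕ) : ℝ))⁻¹) ^ 3) + S * (((((R : ℕ) : ℝ)) + 2)⁻¹) ^ 2 * (3 * R * (Θ * ε₁) + B₀)) := hWB
      rw [hX] at hWB'
      have hL'R : ((L' : ℕ) : ℝ) ≤ ((R : ℕ) : ℝ) := by exact_mod_cast (show L' ≤ R by omega)
      have hR2pos : (0 : ℝ) < (((R : ℕ) : ℝ) + 2) ^ 2 := by positivity
      have h5 : M * (S * (((((R : ℕ) : ℝ)) + 2)⁻¹) ^ 2 * B₀) ≤ M * (ε₁ * R) := by
        refine mul_le_mul_of_nonneg_left ?_ hM0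
        have key : S * B₀ ≤ ((R : ℕ) : ℝ) * (((R : ℕ) : ℝ) + 2) ^ 2 * ε₁ := by
          calc S * B₀ ≤ ((L' : ℕ) : ℝ) ^ 3 * ε₁ := hL2
            _ ≤ ((R : ℕ) : ℝ) * (((R : ℕ) : ℝ) + 2) ^ 2 * ε₁ := by
                refine mul_le_mul_of_nonneg_right ?_ hε₁.le
                calc ((L' : ℕ) : ℝ) ^ 3 ≤ ((R : ℕ) : ℝ) ^ 3 := by gcongr
                  _ ≤ ((R : ℕ) : ℝ) * (((R : ℕ) : ℝ) + 2) ^ 2 := by nlinarith [hRr]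
        calc S * (((((R : ℕ) : ℝ)) + 2)⁻¹) ^ 2 * B₀ = S * B₀ * (((((R : ℕ) : ℝ)) + 2)⁻¹) ^ 2 := by ring
          _ ≤ ((R : ℕ) : ℝ) * (((R : ℕ) : ℝ) + 2) ^ 2 * ε₁ * (((((R : ℕ) : ℝ)) + 2)⁻¹) ^ 2 := mul_le_mul_of_nonneg_right key (by positivity)
          _ = ε₁ * R * ((((R : ℕ) : ℝ) + 2) ^ 2 * ((((R : ℕ) : ℝ) + 2) ^ 2)⁻¹) := by rw [inv_pow]; ring
          _ = ε₁ * R := by rw [mul_inv_cancel₀ hR2pos.ne', mul_one]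
      have hexp : M * (2 * Ch * R * ε₁ + 196 * kernelConst c * (12 * (Θ * ε₁) * (((((R : ℕ) : ℝ)) + 1)⁻¹) ^ 2 +
          7 * B₀ * ((((L' : ℕ) : ℝ))⁻¹) ^ 3) + S * (((((R : ℕ) : ℝ)) + 2)⁻¹) ^ 2 * (3 * R * (Θ * ε₁) + B₀)) =
          M * (2 * Ch * R * ε₁ + 196 * kernelConst c * (12 * (Θ * ε₁) * (((((R : ℕ) : ℝ)) + 1)⁻¹) ^ 2 + 7 * B₀ * ((((L' : ℕ) : ℝ))⁻¹) ^ 3)) +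
          M * (S * (((((R : ℕ) : ℝ)) + 2)⁻¹) ^ 2 * (3 * R * (Θ * ε₁))) + M * (S * (((((R : ℕ) : ℝ)) + 2)⁻¹) ^ 2 * B₀) := by ring
      linarith
  -- the four absorptions
  have t2 : M * (196 * kernelConst c * (12 * (Θ * ε₁) * (((((R : ℕ) : ℝ)) + 1)⁻¹) ^ 2)) ≤ Θ * R * ε₁ / 4 := by
    have hR3 : ((A : ℕ) : ℝ) ^ 3 ≤ ((R : ℕ) : ℝ) * (((R : ℕ) : ℝ) + 1) ^ 2 := by
      calc ((A : ℕ) : ℝ) ^ 3 ≤ ((R : ℕ) : ℝ) ^ 3 := by gcongr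
        _ ≤ ((R : ℕ) : ℝ) * (((R : ℕ) : ℝ) + 1) ^ 2 := by nlinarith
    have key : 2352 * M * kernelConst c * (((((R : ℕ) : ℝ)) + 1)⁻¹) ^ 2 ≤ R / 4 := by
      rw [inv_pow, ← one_div, mul_one_div, div_le_iff₀ (by positivity)]
      linarith
    calc M * (196 * kernelConst c * (12 * (Θ * ε₁) * (((((R : ℕ) : ℝ)) + 1)⁻¹) ^ 2))
        = 2352 * M * kernelConst c * (((((R : ℕ) : ℝ)) + 1)⁻¹) ^ 2 * (Θ * ε₁) := by ring
      _ ≤ R / 4 * (Θ * ε₁) := mul_le_mul_of_nonneg_right key hΘε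
      _ = Θ * R * ε₁ / 4 := by ring
  have t4 : M * (S * (((((R : ℕ) : ℝ)) + 2)⁻¹) ^ 2 * (3 * R * (Θ * ε₁))) ≤ Θ * R * ε₁ / 4 := by
    have hR2 : (((A : ℕ) : ℝ) + 2) ^ 2 ≤ (((R : ℕ) : ℝ) + 2) ^ 2 := by gcongr
    have key : 3 * M * S * (((((R : ℕ) : ℝ)) + 2)⁻¹) ^ 2 ≤ 1 / 4 := by
      rw [inv_pow, ← one_div, mul_one_div, div_le_iff₀ (by positivity)]
      linarith
    calc M * (S * (((((R : ℕ) : ℝ)) + 2)⁻¹) ^ 2 * (3 * R * (Θ * ε₁))) = 3 * M * S * (((((R : ℕ) : ℝ)) + 2)⁻¹) ^ 2 * (R * (Θ * ε₁)) := by ring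
      _ ≤ 1 / 4 * (R * (Θ * ε₁)) := mul_le_mul_of_nonneg_right key (by positivity)
      _ = Θ * R * ε₁ / 4 := by ring
  have t3 : M * (196 * kernelConst c * (7 * B₀ * ((((L' : ℕ) : ℝ))⁻¹) ^ 3)) ≤ M * ε₁ := by
    have key : 1372 * kernelConst c * B₀ * ((((L' : ℕ) : ℝ))⁻¹) ^ 3 ≤ ε₁ := by
      rw [inv_pow, ← one_div, mul_one_div, div_le_iff₀ (by positivity)]
      linarith
    calc M * (196 * kernelConst c * (7 * B₀ * ((((L' : ℕ) : ℝ))⁻¹) ^ 3)) = M * (1372 * kernelConst c * B₀ * ((((L' : ℕ) : ℝ))⁻¹) ^ 3) := by ring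
      _ ≤ M * ε₁ := mul_le_mul_of_nonneg_left key hM0
  have hexp2 : M * (2 * Ch * R * ε₁ + 196 * kernelConst c * (12 * (Θ * ε₁) * (((((R : ℕ) : ℝ)) + 1)⁻¹) ^ 2 + 7 * B₀ * ((((L' : ℕ) : ℝ))⁻¹) ^ 3)) =
      M * (2 * Ch * R * ε₁) + M * (196 * kernelConst c * (12 * (Θ * ε₁) * (((((R : ℕ) : ℝ)) + 1)⁻¹) ^ 2)) +
      M * (196 * kernelConst c * (7 * B₀ * ((((L' : ℕ) : ℝ))⁻¹) ^ 3)) := by ring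
  have hfin : Θ * R * ε₁ ≤ 4 * (M * (Ch * R * ε₁)) + 2 * (M * ε₁) + 2 * (M * (ε₁ * R)) := by linarith [hKEY, t2, t3, t4, hexp2]
  -- divide by `R ε₁ > 0`
  have hRε : 0 < ((R : ℕ) : ℝ) * ε₁ := by positivity
  have h4 : 4 * (M * ε₁) ≤ 4 * (M * ε₁) * R := by
    have h' : 4 * (M * ε₁) * 1 ≤ 4 * (M * ε₁) * R := mul_le_mul_of_nonneg_left hRr (by positivity)
    linarith
  have hmul : Θ * (((R : ℕ) : ℝ) * ε₁) ≤ 4 * M * (Ch + 1) * (((R : ℕ) : ℝ) * ε₁) := by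
    have e1 : Θ * (((R : ℕ) : ℝ) * ε₁) = Θ * R * ε₁ := by ring
    have e2 : 4 * M * (Ch + 1) * (((R : ℕ) : ℝ) * ε₁) = 4 * (M * (Ch * R * ε₁)) + 4 * (M * ε₁) * R := by ring
    rw [e1, e2]
    linarith
  exact le_of_mul_le_mul_right hmul hRε

/-! ### WV.2  The closed statement of this part -/

/-- The content of part WV as one closed proposition: the `ϱ`-free window bootstrap with the cubic a-priori threshold and offset data. -/
def BootstrapCubicShape : Prop :=
  ∀ c : ℝ, ∀ hc : 0 < c, ∀ (a b : E3) (w : ℤ → E3), ∀ hL : IsLayeredCrystal c a b w, ∀ κ₀ ε ϱ : ℝ, 0 ≤ ϱ → ε < 2 * κ₀ →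
    CoerciveZ (layeredKernel a b w) κ₀ →
    (∀ φ : Cell 2 → ℤ → E3, HasFiniteSupport φ → Summable (tailFam ϱ a b w φ) ∧ ∑' x, tailFam ϱ a b w φ x ≤ ε * nnFormZ φ) →
    ∀ (d : ℤ → E3) (T : Finset ℤ) (α₀ : ℤ) (A L' : ℕ), 1 ≤ A → 1 ≤ L' → ∀ Ch ε₁ B₀ : ℝ, 0 ≤ Ch → 0 < ε₁ → 0 ≤ B₀ →
      (∀ n : ℤ, (n - α₀).natAbs ≤ 6 * L' → Icc (n - ⌊ϱ / c⌋₊) (n + 1 + ⌊ϱ / c⌋₊) ⊆ T) →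
      (∀ n : ℤ, (n - α₀).natAbs ≤ 6 * L' → ‖chainFlux ϱ a b w T d n‖ ≤ Ch * (((((n - α₀).natAbs : ℕ)) : ℝ) + A) * ε₁) →
      (∀ k : ℤ, (k - α₀).natAbs ≤ 9 * L' + ⌊ϱ / c⌋₊ → ‖d (k + 1) - d k‖ ≤ B₀) →
      9408 * modeConst c (κ₀ - ε / 2) * kernelConst c ≤ ((A : ℕ) : ℝ) ^ 3 →
      12 * modeConst c (κ₀ - ε / 2) * stabConst c (κ₀ - ε / 2) ≤ (((A : ℕ) : ℝ) + 2) ^ 2 →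
      1372 * kernelConst c * B₀ ≤ ((L' : ℕ) : ℝ) ^ 3 * ε₁ → stabConst c (κ₀ - ε / 2) * B₀ ≤ ((L' : ℕ) : ℝ) ^ 3 * ε₁ →
      ∀ k : ℤ, (k - α₀).natAbs + A ≤ 3 * L' →
        ‖d (k + 1) - d k‖ ≤ 4 * modeConst c (κ₀ - ε / 2) * (Ch + 1) * (((((k - α₀).natAbs : ℕ)) : ℝ) + A) * ε₁

/-- WV holds. [this file, g58] -/
theorem bootstrapCubicShape_holds : BootstrapCubicShape :=
  fun _c hc _a _b _w hL _κ₀ _ε _ϱ hϱ hε hK hT d _T α₀ _A _L' hA hL' _Ch _ε₁ _B₀ hCh hε₁ hB₀ hTc hCF hBd hA1 hA2 hL1 hL2 _k hk =>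
    bootstrap_increment_cubic hc hL hϱ hε hK hT d α₀ hA hL' hCh hε₁ hB₀ hTc hCF hBd hA1 hA2 hL1 hL2 hk

end BootstrapCubic

end Summit.AtomisticToContinuum.Crystallization.Theorems.ChartedZeroExcessLayeredLatticeLiouville
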